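import Literature.Topology.FourManifolds.SignatureTorusSurgeryFibreSum
import Literature.Topology.FourManifolds.TubularSplitting
import Literature.Topology.FourManifolds.GluingProofs
import Literature.AlgebraicTopology.SingularHomology.OnePointProdCupProduct
import HarnessLib

/-!
# Cup-trivial pieces: torus surgery and fibre sum preserve / add the signature

The hypothesis "the closed model `N̂ = N ∪ cone(∂N)` of the piece `N` is cup-trivial in the
middle degree" of `Literature.Topology.FourManifolds.SignatureTorusSurgeryFibreSum` is discharged
for every compact piece `N` whose interior is homeomorphic to a product `F × E` of a compact space
with a non-zero proper real normed space — the tubular pieces `N = F × D²` (`int N ≅ F × ℝ²`) of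
a torus surgery (`F = T²`) and of a fibre sum along a surface (`F = Σ`): `N̂ = (int N)⁺ ≅ (F × E)⁺`
has no non-zero cup products in positive degrees
(`Literature.AlgebraicTopology.SingularHomology.OnePoint.cupProduct_eq_zero_of_homeomorph_prod`,
Hatcher 2002 §3.2 Exercise 2).  Consequently (A. Akhmedov, B. D. Park, Invent. Math. 181 (2010),
§2, §4 and the proof of Lemma 8 in §9; R. Gompf, Ann. of Math. 142 (1995), p. 535; all via
Novikov additivity, R. Kirby, LNM 1374 (1989), Ch. II Thm. 5.3):

* `NullCobordism.cupProduct_closedModel_eq_zero_of_interior_homeomorph` — the discharge;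
* `BoundaryGluingData.exists_signature_eq_of_interior_homeomorph`,
  `BoundaryGluingData.natAbs_signature_eq_of_interior_homeomorph` — **torus surgery** (more
  generally: replacing a piece with product interior by another one, keeping the connected
  complement) **does not change the signature** of a closed oriented smooth `4`-manifold, for the
  appropriate orientation of the result;
* `BoundaryGluingData.exists_signature_fibreSum_eq_add_of_interior_homeomorph` — **the signature
  of a fibre sum is additive**, `σ(M₁ ∪_ψ M₂) = σ(X₁) + σ(X₂)` for suitable orientations, when
  `Xᵢ = Mᵢ ∪ Nᵢ` with `int Nᵢ ≅ Fᵢ × E`, `Mᵢ` connected;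
* **in tube coordinates** (`TubularSplitting.lean`: a tube `T : F × ℝ² → Y` with a tube function
  `g`, `N = {g ≤ ¼}`, `M = {¼ ≤ g}`): `exists_signature_eq_of_tube_surgery` — any closed smooth
  oriented `4`-manifold `P` obtained by gluing the tube complement `M` of a closed connected
  oriented `Y` to a compact piece with product interior (a *surgery along `F`*) has `σ(P) = σ(Y)`
  for suitable orientations; `exists_signature_eq_of_tube_regluing` — in particular for the
  regluing of the tube piece itself along any identification of the boundaries (torus surgery,
  `F = T²`); `exists_signature_eq_add_of_tube_fibreSum`
  — any gluing `P` of two tube complements `M₁ ⊆ Y₁`, `M₂ ⊆ Y₂` (a *fibre sum*) has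
  `σ(P) = σ(Y₁) + σ(Y₂)` for suitable orientations.

Everything is proved; no definitions, no named facts.

## References

* A. Akhmedov, B. D. Park, Invent. Math. 181 (2010) 577–603, §2, §4, §9. [AkhmedovPark2010]
* R. E. Gompf, Ann. of Math. 142 (1995) 527–595, p. 535. [Gompf1995]
* R. C. Kirby, *The topology of 4-manifolds*, LNM 1374 (1989), Ch. II §5 Thm. 5.3. [Kirby1989]
* A. Hatcher, *Algebraic Topology* (2002), §3.2 Exercise 2. [HatcherAT2002]
-/

noncomputable section

open scoped Manifold ContDiff Topology
open Set Function
open Literature.AlgebraicTopology.SingularHomology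

namespace Literature.Topology.FourManifolds

namespace NullCobordism

/-- **A compact piece with product interior has a cup-trivial closed model**: if
`int N ≅ F × E` with `F` compact and `E ≠ 0` a proper real normed space (e.g. `N = F × D²`,
`int N ≅ F × ℝ²`), then `a ⌣ b = 0` for all positive-degree classes `a`, `b` of
`N̂ = (int N)⁺ ≅ (F × E)⁺` (Hatcher 2002, §3.2 Exercise 2: `(F × E)⁺` is the union of two
contractible open cones). [cite: HatcherAT2002, §3.2 Exercise 2] -/
theorem cupProduct_closedModel_eq_zero_of_interior_homeomorph {n : ℕ} {S : Type}
    [TopologicalSpace S] [ChartedSpace (EuclideanSpace ℝ (Fin n)) S] (c : NullCobordism n S)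
    {F E : Type} [TopologicalSpace F] [CompactSpace F] [NormedAddCommGroup E] [NormedSpace ℝ E]
    [ProperSpace E] [Nontrivial E] (e : ManifoldInterior n c.W ≃ₜ F × E)
    {p q k : ℕ} (hp : p ≠ 0) (hq : q ≠ 0) (h : p + q = k)
    (a : singularCohomology ℤ ℤ (ClosedModel n c.W) p)
    (b : singularCohomology ℤ ℤ (ClosedModel n c.W) q) : cupProduct h a b = 0 :=
  OnePoint.cupProduct_eq_zero_of_homeomorph_prod ℤ e hp hq h a b

end NullCobordism

namespace BoundaryGluingData

/-- **Torus surgery (piece replacement with product interiors) preserves the signature up to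
orientation, in dimension four.**  `P = M ∪_φ N`, `P' = M ∪_φ' N'` closed smooth `4`-manifolds
glued from the same connected compact piece `M` and compact pieces `N`, `N'` with
`int N ≅ F × E`, `int N' ≅ F' × E'` (torus surgery: `N = N' = T² × D²`, `F = F' = T²`,
`E = E' = ℝ²`): for every orientation `μ` of `P` and `μ'` of `P'` there is an orientation `μ''` of
`P'` with `σ(P', μ'') = σ(P, μ)` (Akhmedov–Park 2010, §2: the torus-surgered `Y_n(m)` keep the
signature `0`; §4: "`σ(Z') = σ(Z''(1/q, m/r)) = -1`"). [cite: AkhmedovPark2010, §2 and §4; Kirby1989, Ch. II §5, Thm. 5.3] -/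
theorem exists_signature_eq_of_interior_homeomorph
    {S : Type} [TopologicalSpace S] [ChartedSpace (EuclideanSpace ℝ (Fin 3)) S]
    [IsManifold (𝓡 3) ∞ S] [CompactSpace S] [Nonempty S] [T2Space S]
    {S' : Type} [TopologicalSpace S'] [ChartedSpace (EuclideanSpace ℝ (Fin 3)) S']
    [IsManifold (𝓡 3) ∞ S'] [CompactSpace S'] [Nonempty S'] [T2Space S']
    {S'' : Type} [TopologicalSpace S''] [ChartedSpace (EuclideanSpace ℝ (Fin 3)) S'']
    [IsManifold (𝓡 3) ∞ S''] [CompactSpace S''] [Nonempty S''] [T2Space S'']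
    {cM : NullCobordism 3 S} {cN : NullCobordism 3 S'} {cN' : NullCobordism 3 S''}
    {φ : S ≃ S'} {φ' : S ≃ S''}
    {P : Type} [TopologicalSpace P] [T2Space P] [CompactSpace P]
    [ChartedSpace (EuclideanSpace ℝ (Fin 4)) P] [IsManifold (𝓡 4) ∞ P]
    {P' : Type} [TopologicalSpace P'] [T2Space P'] [CompactSpace P']
    [ChartedSpace (EuclideanSpace ℝ (Fin 4)) P'] [IsManifold (𝓡 4) ∞ P']
    (G : BoundaryGluingData cM.boundaryData cN.boundaryData φ P)
    (G' : BoundaryGluingData cM.boundaryData cN'.boundaryData φ' P') [ConnectedSpace cM.W]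
    {F E : Type} [TopologicalSpace F] [CompactSpace F] [NormedAddCommGroup E] [NormedSpace ℝ E]
    [ProperSpace E] [Nontrivial E] (eN : ManifoldInterior 3 cN.W ≃ₜ F × E)
    {F' E' : Type} [TopologicalSpace F'] [CompactSpace F'] [NormedAddCommGroup E']
    [NormedSpace ℝ E'] [ProperSpace E'] [Nontrivial E'] (eN' : ManifoldInterior 3 cN'.W ≃ₜ F' × E')
    (μ : HomologicalOrientation ℤ P 4) (μ' : HomologicalOrientation ℤ P' 4) :
    ∃ μ'' : HomologicalOrientation ℤ P' 4, μ''.signature = μ.signature :=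
  G.exists_signature_eq_of_cupProduct_eq_zero G'
    (cN.cupProduct_closedModel_eq_zero_of_interior_homeomorph eN two_ne_zero two_ne_zero _)
    (cN'.cupProduct_closedModel_eq_zero_of_interior_homeomorph eN' two_ne_zero two_ne_zero _) μ μ'

/-- **`|σ(P')| = |σ(P)|` under torus surgery / piece replacement with product interiors** (same
hypotheses). [cite: AkhmedovPark2010, §2 and §4; Kirby1989, Ch. II §5, Thm. 5.3] -/
theorem natAbs_signature_eq_of_interior_homeomorph
    {S : Type} [TopologicalSpace S] [ChartedSpace (EuclideanSpace ℝ (Fin 3)) S]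
    [IsManifold (𝓡 3) ∞ S] [CompactSpace S] [Nonempty S] [T2Space S]
    {S' : Type} [TopologicalSpace S'] [ChartedSpace (EuclideanSpace ℝ (Fin 3)) S']
    [IsManifold (𝓡 3) ∞ S'] [CompactSpace S'] [Nonempty S'] [T2Space S']
    {S'' : Type} [TopologicalSpace S''] [ChartedSpace (EuclideanSpace ℝ (Fin 3)) S'']
    [IsManifold (𝓡 3) ∞ S''] [CompactSpace S''] [Nonempty S''] [T2Space S'']
    {cM : NullCobordism 3 S} {cN : NullCobordism 3 S'} {cN' : NullCobordism 3 S''}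
    {φ : S ≃ S'} {φ' : S ≃ S''}
    {P : Type} [TopologicalSpace P] [T2Space P] [CompactSpace P]
    [ChartedSpace (EuclideanSpace ℝ (Fin 4)) P] [IsManifold (𝓡 4) ∞ P]
    {P' : Type} [TopologicalSpace P'] [T2Space P'] [CompactSpace P']
    [ChartedSpace (EuclideanSpace ℝ (Fin 4)) P'] [IsManifold (𝓡 4) ∞ P']
    (G : BoundaryGluingData cM.boundaryData cN.boundaryData φ P)
    (G' : BoundaryGluingData cM.boundaryData cN'.boundaryData φ' P') [ConnectedSpace cM.W]
    {F E : Type} [TopologicalSpace F] [CompactSpace F] [NormedAddCommGroup E] [NormedSpace ℝ E]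
    [ProperSpace E] [Nontrivial E] (eN : ManifoldInterior 3 cN.W ≃ₜ F × E)
    {F' E' : Type} [TopologicalSpace F'] [CompactSpace F'] [NormedAddCommGroup E']
    [NormedSpace ℝ E'] [ProperSpace E'] [Nontrivial E'] (eN' : ManifoldInterior 3 cN'.W ≃ₜ F' × E')
    (μ : HomologicalOrientation ℤ P 4) (μ' : HomologicalOrientation ℤ P' 4) :
    μ'.signature.natAbs = μ.signature.natAbs :=
  G.natAbs_signature_eq_of_cupProduct_eq_zero G'
    (cN.cupProduct_closedModel_eq_zero_of_interior_homeomorph eN two_ne_zero two_ne_zero _)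
    (cN'.cupProduct_closedModel_eq_zero_of_interior_homeomorph eN' two_ne_zero two_ne_zero _) μ μ'

/-- **The signature of a four-dimensional fibre sum along product-interior pieces is additive for
suitable orientations**: `Xᵢ = Mᵢ ∪ Nᵢ` closed smooth `4`-manifolds with `int Nᵢ ≅ Fᵢ × Eᵢ`
(fibre sum along a surface `Σ` of self-intersection `0`: `Nᵢ = Σ × D²`, `int Nᵢ ≅ Σ × ℝ²`) and
`Mᵢ` connected, `P = M₁ ∪_ψ M₂`: `σ(P, μ) = σ(X₁, μ₁') + σ(X₂, μ₂')` for some orientations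
(Gompf 1995, p. 535; Akhmedov–Park 2010, proof of Lemma 8: "`σ(X₁(m)) = σ(Y₁(1,1)) + σ(Z''(1,m))`").
[cite: Gompf1995, p. 535; AkhmedovPark2010, §9 proof of Lemma 8; Kirby1989, Ch. II §5, Thm. 5.3] -/
theorem exists_signature_fibreSum_eq_add_of_interior_homeomorph
    {S₁ : Type} [TopologicalSpace S₁] [ChartedSpace (EuclideanSpace ℝ (Fin 3)) S₁]
    [IsManifold (𝓡 3) ∞ S₁] [CompactSpace S₁] [Nonempty S₁] [T2Space S₁]
    {S₁' : Type} [TopologicalSpace S₁'] [ChartedSpace (EuclideanSpace ℝ (Fin 3)) S₁']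
    [IsManifold (𝓡 3) ∞ S₁'] [CompactSpace S₁'] [Nonempty S₁'] [T2Space S₁']
    {S₂ : Type} [TopologicalSpace S₂] [ChartedSpace (EuclideanSpace ℝ (Fin 3)) S₂]
    [IsManifold (𝓡 3) ∞ S₂] [CompactSpace S₂] [Nonempty S₂] [T2Space S₂]
    {S₂' : Type} [TopologicalSpace S₂'] [ChartedSpace (EuclideanSpace ℝ (Fin 3)) S₂']
    [IsManifold (𝓡 3) ∞ S₂'] [CompactSpace S₂'] [Nonempty S₂'] [T2Space S₂']
    {cM₁ : NullCobordism 3 S₁} {cN₁ : NullCobordism 3 S₁'}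
    {cM₂ : NullCobordism 3 S₂} {cN₂ : NullCobordism 3 S₂'}
    {φ₁ : S₁ ≃ S₁'} {φ₂ : S₂ ≃ S₂'} {ψ : S₁ ≃ S₂}
    {X₁ : Type} [TopologicalSpace X₁] [T2Space X₁] [CompactSpace X₁]
    [ChartedSpace (EuclideanSpace ℝ (Fin 4)) X₁] [IsManifold (𝓡 4) ∞ X₁]
    {X₂ : Type} [TopologicalSpace X₂] [T2Space X₂] [CompactSpace X₂]
    [ChartedSpace (EuclideanSpace ℝ (Fin 4)) X₂] [IsManifold (𝓡 4) ∞ X₂]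
    {P : Type} [TopologicalSpace P] [T2Space P] [CompactSpace P]
    [ChartedSpace (EuclideanSpace ℝ (Fin 4)) P] [IsManifold (𝓡 4) ∞ P]
    (G₁ : BoundaryGluingData cM₁.boundaryData cN₁.boundaryData φ₁ X₁)
    (G₂ : BoundaryGluingData cM₂.boundaryData cN₂.boundaryData φ₂ X₂)
    (G : BoundaryGluingData cM₁.boundaryData cM₂.boundaryData ψ P)
    [ConnectedSpace cM₁.W] [ConnectedSpace cM₂.W]
    {F₁ E₁ : Type} [TopologicalSpace F₁] [CompactSpace F₁] [NormedAddCommGroup E₁]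
    [NormedSpace ℝ E₁] [ProperSpace E₁] [Nontrivial E₁] (e₁ : ManifoldInterior 3 cN₁.W ≃ₜ F₁ × E₁)
    {F₂ E₂ : Type} [TopologicalSpace F₂] [CompactSpace F₂] [NormedAddCommGroup E₂]
    [NormedSpace ℝ E₂] [ProperSpace E₂] [Nontrivial E₂] (e₂ : ManifoldInterior 3 cN₂.W ≃ₜ F₂ × E₂)
    (μ₁ : HomologicalOrientation ℤ X₁ 4) (μ₂ : HomologicalOrientation ℤ X₂ 4)
    (μ : HomologicalOrientation ℤ P 4) :
    ∃ (μ₁' : HomologicalOrientation ℤ X₁ 4) (μ₂' : HomologicalOrientation ℤ X₂ 4),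
      μ.signature = μ₁'.signature + μ₂'.signature :=
  exists_signature_fibreSum_eq_add G₁ G₂ G
    (cN₁.cupProduct_closedModel_eq_zero_of_interior_homeomorph e₁ two_ne_zero two_ne_zero _)
    (cN₂.cupProduct_closedModel_eq_zero_of_interior_homeomorph e₂ two_ne_zero two_ne_zero _)
    μ₁ μ₂ μ

end BoundaryGluingData

/-! ### In tube coordinates: surgery along `F` and fibre sum -/

section Tube

variable {Y : Type} [TopologicalSpace Y] [T2Space Y] [SecondCountableTopology Y] [CompactSpace Y]
  [ConnectedSpace Y] [ChartedSpace (EuclideanSpace ℝ (Fin 4)) Y] [IsManifold (𝓡 4) ∞ Y]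
  {F : Type} [TopologicalSpace F] [CompactSpace F] [ConnectedSpace F]
  {T : F × EuclideanSpace ℝ (Fin 2) → Y} {g : Y → ℝ}

/-- **Surgery along `F` (torus surgery for `F = T²`) does not change the signature.**  Let `Y` be
a closed connected smooth `4`-manifold, `T : F × ℝ² → Y` a topological embedding with a tube
function `g` (`TubularSplitting.lean`: regular level `¼`, `{g ≤ ¼} = T(F × B̄(0, ½))`, `g ≡ 1`
off the tube; `exists_tube_function`), `F` connected.  Let `P` be any closed smooth `4`-manifold
which is a boundary gluing of the tube complement `M = {¼ ≤ g}` with a compact piece `N'` whose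
interior is a product `F' × E'` (for a torus surgery: `N' = T² × D²`, glued back by a
diffeomorphism of `T³`).  Then for every orientation `μ` of `Y` and `μ'` of `P` there is an
orientation `μ''` of `P` with `σ(P, μ'') = σ(Y, μ)` (Akhmedov–Park 2010, §2 and §4: the torus
surgeries do not change `e` and `σ`).  Proof: `Y = M ∪ N` along the regular level
(`RegularSublevel.isBoundaryGluing_split`), `M` is connected
(`connectedSpace_regularSuperlevel_tube`),
`int N ≅ F × ℝ²` (`nonempty_manifoldInterior_regularSublevel_homeomorph_tube`), and
`exists_signature_eq_of_interior_homeomorph`. [cite: AkhmedovPark2010, §2 and §4; Kirby1989, Ch. II §5, Thm. 5.3] -/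
theorem exists_signature_eq_of_tube_surgery (hT : Topology.IsEmbedding T)
    (hreg : IsRegularLevel (𝓡 4) g (1 / 4)) (hle : ∀ x, g (T x) ≤ 1 / 4 ↔ ‖x.2‖ ≤ 1 / 2)
    (hlt : ∀ x, g (T x) < 1 / 4 ↔ ‖x.2‖ < 1 / 2) (hout : ∀ y, y ∉ range T → g y = 1)
    {S' : Type} [TopologicalSpace S'] [ChartedSpace (EuclideanSpace ℝ (Fin 3)) S']
    [IsManifold (𝓡 3) ∞ S'] [CompactSpace S'] [Nonempty S'] [T2Space S'] (cN' : NullCobordism 3 S')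
    {F' E' : Type} [TopologicalSpace F'] [CompactSpace F'] [NormedAddCommGroup E']
    [NormedSpace ℝ E'] [ProperSpace E'] [Nontrivial E'] (eN' : ManifoldInterior 3 cN'.W ≃ₜ F' × E')
    {P : Type} [TopologicalSpace P] [T2Space P] [CompactSpace P]
    [ChartedSpace (EuclideanSpace ℝ (Fin 4)) P] [IsManifold (𝓡 4) ∞ P]
    {φ : (RegularSublevel.boundaryData hreg.const_sub).carrier ≃ S'}
    (GP : BoundaryGluingData (RegularSublevel.boundaryData hreg.const_sub) cN'.boundaryData φ P)
    (μ : HomologicalOrientation ℤ Y 4) (μ' : HomologicalOrientation ℤ P 4) :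
    ∃ μ'' : HomologicalOrientation ℤ P 4, μ''.signature = μ.signature := by
  haveI : Nonempty F := ConnectedSpace.toNonempty
  -- the two pieces of `Y` as null-cobordisms of their boundaries
  let bN := RegularSublevel.boundaryData hreg
  let bM := RegularSublevel.boundaryData hreg.const_sub
  let cN : NullCobordism 3 bN.carrier :=
    { W := RegularSublevel hreg
      incl := bN.incl
      isSmoothEmbedding_incl := bN.isSmoothEmbedding
      range_incl := bN.range_incl }
  let cM : NullCobordism 3 bM.carrier :=
    { W := RegularSuperlevel hreg
      incl := bM.incl
      isSmoothEmbedding_incl := bM.isSmoothEmbedding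
      range_incl := bM.range_incl }
  -- the boundaries are nonempty compact (the level `T(F × S(0, ½))`)
  have hlevel : (g ⁻¹' {1 / 4}).Nonempty := by
    rw [level_eq_image_tube hle hlt hout]
    obtain ⟨v, hv⟩ : (Metric.sphere (0 : EuclideanSpace ℝ (Fin 2)) (1 / 2)).Nonempty :=
      (NormedSpace.sphere_nonempty).2 (by norm_num)
    exact ⟨T (Classical.arbitrary F, v), (Classical.arbitrary F, v), ⟨mem_univ _, hv⟩, rfl⟩
  obtain ⟨y₀, hy₀⟩ := hlevel
  simp only [mem_preimage, mem_singleton_iff] at hy₀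
  haveI : Nonempty bN.carrier :=
    ⟨⟨RegularSublevel.mk hreg y₀ hy₀.le, (RegularSublevel.mem_boundary_iff hreg _).2 hy₀⟩⟩
  haveI : Nonempty bM.carrier :=
    ⟨⟨RegularSublevel.mk hreg.const_sub y₀ (by show 1 / 4 - g y₀ ≤ 0; rw [hy₀]; norm_num),
      (RegularSublevel.mem_boundary_iff hreg.const_sub _).2
        (by show 1 / 4 - g y₀ = 0; rw [hy₀]; norm_num)⟩⟩
  haveI : CompactSpace bN.carrier := by
    haveI : CompactSpace ↥((𝓡∂ 4).boundary (RegularSublevel hreg)) :=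
      isCompact_iff_compactSpace.1 (isCompact_boundary (n := 3) (W := RegularSublevel hreg))
    exact this
  haveI : CompactSpace bM.carrier := by
    haveI : CompactSpace ↥((𝓡∂ 4).boundary (RegularSuperlevel hreg)) :=
      isCompact_iff_compactSpace.1 (isCompact_boundary (n := 3) (W := RegularSuperlevel hreg))
    exact this
  haveI : T2Space bN.carrier := inferInstanceAs (T2Space ↥((𝓡∂ 4).boundary (RegularSublevel hreg)))
  haveI : T2Space bM.carrier :=
    inferInstanceAs (T2Space ↥((𝓡∂ 4).boundary (RegularSuperlevel hreg)))
  -- `Y = M ∪ N` along the level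
  obtain ⟨G₀⟩ := (RegularSublevel.isBoundaryGluing_split hreg).nonempty_boundaryGluingData'
  let GY : BoundaryGluingData cM.boundaryData cN.boundaryData
      (RegularSublevel.splitDiffeomorph hreg).toEquiv.symm Y := G₀.symm
  let GP' : BoundaryGluingData cM.boundaryData cN'.boundaryData φ P := GP
  -- connectedness of the complement, product interior of the tube piece
  haveI : ConnectedSpace cM.W :=
    connectedSpace_regularSuperlevel_tube (le_refl 2) hT.continuous hreg hle hlt hout
  obtain ⟨eN⟩ := nonempty_manifoldInterior_regularSublevel_homeomorph_tube hT hreg hlt hout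
  exact GY.exists_signature_eq_of_interior_homeomorph GP' (eN : ManifoldInterior 3 cN.W ≃ₜ _) eN'
    μ μ'

/-- **Torus surgery proper: regluing the tube piece.**  With `Y`, `T`, `g` as in
`exists_signature_eq_of_tube_surgery`, let `P` be any closed smooth `4`-manifold which is a
boundary gluing of the tube complement `M = {¼ ≤ g}` with the tube piece `N = {g ≤ ¼} ≅ F × D²`
itself, along ANY identification `φ'` of their boundaries (for `F = T²`: a torus surgery /
logarithmic transformation, Gompf–Stipsicz 1999 §8.3; the Luttinger and `m`-torus surgeries of
Akhmedov–Park 2010, §2 and §4).  Then `σ(P, μ'') = σ(Y, μ)` for a suitable orientation `μ''` of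
`P`. [cite: AkhmedovPark2010, §2 and §4; Kirby1989, Ch. II §5, Thm. 5.3] -/
theorem exists_signature_eq_of_tube_regluing (hT : Topology.IsEmbedding T)
    (hreg : IsRegularLevel (𝓡 4) g (1 / 4)) (hle : ∀ x, g (T x) ≤ 1 / 4 ↔ ‖x.2‖ ≤ 1 / 2)
    (hlt : ∀ x, g (T x) < 1 / 4 ↔ ‖x.2‖ < 1 / 2) (hout : ∀ y, y ∉ range T → g y = 1)
    {P : Type} [TopologicalSpace P] [T2Space P] [CompactSpace P]
    [ChartedSpace (EuclideanSpace ℝ (Fin 4)) P] [IsManifold (𝓡 4) ∞ P]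
    {φ' : (RegularSublevel.boundaryData hreg.const_sub).carrier ≃
      (RegularSublevel.boundaryData hreg).carrier}
    (GP : BoundaryGluingData (RegularSublevel.boundaryData hreg.const_sub)
      (RegularSublevel.boundaryData hreg) φ' P)
    (μ : HomologicalOrientation ℤ Y 4) (μ' : HomologicalOrientation ℤ P 4) :
    ∃ μ'' : HomologicalOrientation ℤ P 4, μ''.signature = μ.signature := by
  haveI : Nonempty F := ConnectedSpace.toNonempty
  let bN := RegularSublevel.boundaryData hreg
  let cN : NullCobordism 3 bN.carrier :=
    { W := RegularSublevel hreg
      incl := bN.incl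
      isSmoothEmbedding_incl := bN.isSmoothEmbedding
      range_incl := bN.range_incl }
  have hlevel : (g ⁻¹' {1 / 4}).Nonempty := by
    rw [level_eq_image_tube hle hlt hout]
    obtain ⟨v, hv⟩ : (Metric.sphere (0 : EuclideanSpace ℝ (Fin 2)) (1 / 2)).Nonempty :=
      (NormedSpace.sphere_nonempty).2 (by norm_num)
    exact ⟨T (Classical.arbitrary F, v), (Classical.arbitrary F, v), ⟨mem_univ _, hv⟩, rfl⟩
  obtain ⟨y₀, hy₀⟩ := hlevel
  simp only [mem_preimage, mem_singleton_iff] at hy₀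
  haveI : Nonempty bN.carrier :=
    ⟨⟨RegularSublevel.mk hreg y₀ hy₀.le, (RegularSublevel.mem_boundary_iff hreg _).2 hy₀⟩⟩
  haveI : CompactSpace bN.carrier := by
    haveI : CompactSpace ↥((𝓡∂ 4).boundary (RegularSublevel hreg)) :=
      isCompact_iff_compactSpace.1 (isCompact_boundary (n := 3) (W := RegularSublevel hreg))
    exact this
  haveI : T2Space bN.carrier := inferInstanceAs (T2Space ↥((𝓡∂ 4).boundary (RegularSublevel hreg)))
  obtain ⟨eN⟩ := nonempty_manifoldInterior_regularSublevel_homeomorph_tube hT hreg hlt hout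
  exact exists_signature_eq_of_tube_surgery hT hreg hle hlt hout cN
    (eN : ManifoldInterior 3 cN.W ≃ₜ _) (GP : BoundaryGluingData _ cN.boundaryData φ' P) μ μ'

/-- **The signature of a fibre sum in tube coordinates.**  Let `Y₁`, `Y₂` be closed connected
smooth `4`-manifolds with tubes `Tᵢ : Fᵢ × ℝ² → Yᵢ` (`Fᵢ` connected) and tube functions `gᵢ`,
and let `P` be any closed smooth `4`-manifold which is a boundary gluing of the two tube
complements `M₁ = {¼ ≤ g₁}`, `M₂ = {¼ ≤ g₂}` (the generalised fibre sum `Y₁ #_F Y₂` along any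
identification of the boundaries `Fᵢ × S¹`).  Then for all orientations `μ₁`, `μ₂`, `μ` there
are orientations `μ₁'`, `μ₂'` of `Y₁`, `Y₂` with `σ(P, μ) = σ(Y₁, μ₁') + σ(Y₂, μ₂')` (Gompf 1995,
p. 535; Akhmedov–Park 2010, proof of Lemma 8: "`σ(X₁(m)) = σ(Y₁(1,1)) + σ(Z''(1,m))`").
[cite: Gompf1995, p. 535; AkhmedovPark2010, §9 proof of Lemma 8; Kirby1989, Ch. II §5, Thm. 5.3] -/
theorem exists_signature_eq_add_of_tube_fibreSum (hT : Topology.IsEmbedding T)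
    (hreg : IsRegularLevel (𝓡 4) g (1 / 4)) (hle : ∀ x, g (T x) ≤ 1 / 4 ↔ ‖x.2‖ ≤ 1 / 2)
    (hlt : ∀ x, g (T x) < 1 / 4 ↔ ‖x.2‖ < 1 / 2) (hout : ∀ y, y ∉ range T → g y = 1)
    {Y₂ : Type} [TopologicalSpace Y₂] [T2Space Y₂] [SecondCountableTopology Y₂] [CompactSpace Y₂]
    [ConnectedSpace Y₂] [ChartedSpace (EuclideanSpace ℝ (Fin 4)) Y₂] [IsManifold (𝓡 4) ∞ Y₂]
    {F₂ : Type} [TopologicalSpace F₂] [CompactSpace F₂] [ConnectedSpace F₂]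
    {T₂ : F₂ × EuclideanSpace ℝ (Fin 2) → Y₂} {g₂ : Y₂ → ℝ} (hT₂ : Topology.IsEmbedding T₂)
    (hreg₂ : IsRegularLevel (𝓡 4) g₂ (1 / 4)) (hle₂ : ∀ x, g₂ (T₂ x) ≤ 1 / 4 ↔ ‖x.2‖ ≤ 1 / 2)
    (hlt₂ : ∀ x, g₂ (T₂ x) < 1 / 4 ↔ ‖x.2‖ < 1 / 2) (hout₂ : ∀ y, y ∉ range T₂ → g₂ y = 1)
    {P : Type} [TopologicalSpace P] [T2Space P] [CompactSpace P]
    [ChartedSpace (EuclideanSpace ℝ (Fin 4)) P] [IsManifold (𝓡 4) ∞ P]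
    {ψ : (RegularSublevel.boundaryData hreg.const_sub).carrier ≃
      (RegularSublevel.boundaryData hreg₂.const_sub).carrier}
    (GP : BoundaryGluingData (RegularSublevel.boundaryData hreg.const_sub)
      (RegularSublevel.boundaryData hreg₂.const_sub) ψ P)
    (μ₁ : HomologicalOrientation ℤ Y 4) (μ₂ : HomologicalOrientation ℤ Y₂ 4)
    (μ : HomologicalOrientation ℤ P 4) :
    ∃ (μ₁' : HomologicalOrientation ℤ Y 4) (μ₂' : HomologicalOrientation ℤ Y₂ 4),
      μ.signature = μ₁'.signature + μ₂'.signature := by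
  haveI : Nonempty F := ConnectedSpace.toNonempty
  haveI : Nonempty F₂ := ConnectedSpace.toNonempty
  -- the pieces as null-cobordisms
  let bN₁ := RegularSublevel.boundaryData hreg
  let bM₁ := RegularSublevel.boundaryData hreg.const_sub
  let bN₂ := RegularSublevel.boundaryData hreg₂
  let bM₂ := RegularSublevel.boundaryData hreg₂.const_sub
  let cN₁ : NullCobordism 3 bN₁.carrier :=
    { W := RegularSublevel hreg
      incl := bN₁.incl
      isSmoothEmbedding_incl := bN₁.isSmoothEmbedding
      range_incl := bN₁.range_incl }
  let cM₁ : NullCobordism 3 bM₁.carrier :=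
    { W := RegularSuperlevel hreg
      incl := bM₁.incl
      isSmoothEmbedding_incl := bM₁.isSmoothEmbedding
      range_incl := bM₁.range_incl }
  let cN₂ : NullCobordism 3 bN₂.carrier :=
    { W := RegularSublevel hreg₂
      incl := bN₂.incl
      isSmoothEmbedding_incl := bN₂.isSmoothEmbedding
      range_incl := bN₂.range_incl }
  let cM₂ : NullCobordism 3 bM₂.carrier :=
    { W := RegularSuperlevel hreg₂
      incl := bM₂.incl
      isSmoothEmbedding_incl := bM₂.isSmoothEmbedding
      range_incl := bM₂.range_incl }
  -- nonempty compact boundaries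
  have hlevel₁ : (g ⁻¹' {1 / 4}).Nonempty := by
    rw [level_eq_image_tube hle hlt hout]
    obtain ⟨v, hv⟩ : (Metric.sphere (0 : EuclideanSpace ℝ (Fin 2)) (1 / 2)).Nonempty :=
      (NormedSpace.sphere_nonempty).2 (by norm_num)
    exact ⟨T (Classical.arbitrary F, v), (Classical.arbitrary F, v), ⟨mem_univ _, hv⟩, rfl⟩
  have hlevel₂ : (g₂ ⁻¹' {1 / 4}).Nonempty := by
    rw [level_eq_image_tube hle₂ hlt₂ hout₂]
    obtain ⟨v, hv⟩ : (Metric.sphere (0 : EuclideanSpace ℝ (Fin 2)) (1 / 2)).Nonempty :=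
      (NormedSpace.sphere_nonempty).2 (by norm_num)
    exact ⟨T₂ (Classical.arbitrary F₂, v), (Classical.arbitrary F₂, v), ⟨mem_univ _, hv⟩, rfl⟩
  obtain ⟨y₁, hy₁⟩ := hlevel₁
  obtain ⟨y₂, hy₂⟩ := hlevel₂
  simp only [mem_preimage, mem_singleton_iff] at hy₁ hy₂
  haveI : Nonempty bN₁.carrier :=
    ⟨⟨RegularSublevel.mk hreg y₁ hy₁.le, (RegularSublevel.mem_boundary_iff hreg _).2 hy₁⟩⟩
  haveI : Nonempty bM₁.carrier :=
    ⟨⟨RegularSublevel.mk hreg.const_sub y₁ (by show 1 / 4 - g y₁ ≤ 0; rw [hy₁]; norm_num),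
      (RegularSublevel.mem_boundary_iff hreg.const_sub _).2
        (by show 1 / 4 - g y₁ = 0; rw [hy₁]; norm_num)⟩⟩
  haveI : Nonempty bN₂.carrier :=
    ⟨⟨RegularSublevel.mk hreg₂ y₂ hy₂.le, (RegularSublevel.mem_boundary_iff hreg₂ _).2 hy₂⟩⟩
  haveI : Nonempty bM₂.carrier :=
    ⟨⟨RegularSublevel.mk hreg₂.const_sub y₂ (by show 1 / 4 - g₂ y₂ ≤ 0; rw [hy₂]; norm_num),
      (RegularSublevel.mem_boundary_iff hreg₂.const_sub _).2
        (by show 1 / 4 - g₂ y₂ = 0; rw [hy₂]; norm_num)⟩⟩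
  haveI : CompactSpace bN₁.carrier := by
    haveI : CompactSpace ↥((𝓡∂ 4).boundary (RegularSublevel hreg)) :=
      isCompact_iff_compactSpace.1 (isCompact_boundary (n := 3) (W := RegularSublevel hreg))
    exact this
  haveI : CompactSpace bM₁.carrier := by
    haveI : CompactSpace ↥((𝓡∂ 4).boundary (RegularSuperlevel hreg)) :=
      isCompact_iff_compactSpace.1 (isCompact_boundary (n := 3) (W := RegularSuperlevel hreg))
    exact this
  haveI : CompactSpace bN₂.carrier := by
    haveI : CompactSpace ↥((𝓡∂ 4).boundary (RegularSublevel hreg₂)) :=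
      isCompact_iff_compactSpace.1 (isCompact_boundary (n := 3) (W := RegularSublevel hreg₂))
    exact this
  haveI : CompactSpace bM₂.carrier := by
    haveI : CompactSpace ↥((𝓡∂ 4).boundary (RegularSuperlevel hreg₂)) :=
      isCompact_iff_compactSpace.1 (isCompact_boundary (n := 3) (W := RegularSuperlevel hreg₂))
    exact this
  haveI : T2Space bN₁.carrier :=
    inferInstanceAs (T2Space ↥((𝓡∂ 4).boundary (RegularSublevel hreg)))
  haveI : T2Space bM₁.carrier :=
    inferInstanceAs (T2Space ↥((𝓡∂ 4).boundary (RegularSuperlevel hreg)))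
  haveI : T2Space bN₂.carrier :=
    inferInstanceAs (T2Space ↥((𝓡∂ 4).boundary (RegularSublevel hreg₂)))
  haveI : T2Space bM₂.carrier :=
    inferInstanceAs (T2Space ↥((𝓡∂ 4).boundary (RegularSuperlevel hreg₂)))
  -- the splittings `Yᵢ = Mᵢ ∪ Nᵢ`
  obtain ⟨G₁₀⟩ := (RegularSublevel.isBoundaryGluing_split hreg).nonempty_boundaryGluingData'
  obtain ⟨G₂₀⟩ := (RegularSublevel.isBoundaryGluing_split hreg₂).nonempty_boundaryGluingData'
  let G₁ : BoundaryGluingData cM₁.boundaryData cN₁.boundaryData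
      (RegularSublevel.splitDiffeomorph hreg).toEquiv.symm Y := G₁₀.symm
  let G₂ : BoundaryGluingData cM₂.boundaryData cN₂.boundaryData
      (RegularSublevel.splitDiffeomorph hreg₂).toEquiv.symm Y₂ := G₂₀.symm
  let G : BoundaryGluingData cM₁.boundaryData cM₂.boundaryData ψ P := GP
  haveI : ConnectedSpace cM₁.W :=
    connectedSpace_regularSuperlevel_tube (le_refl 2) hT.continuous hreg hle hlt hout
  haveI : ConnectedSpace cM₂.W :=
    connectedSpace_regularSuperlevel_tube (le_refl 2) hT₂.continuous hreg₂ hle₂ hlt₂ hout₂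
  obtain ⟨e₁⟩ := nonempty_manifoldInterior_regularSublevel_homeomorph_tube hT hreg hlt hout
  obtain ⟨e₂⟩ := nonempty_manifoldInterior_regularSublevel_homeomorph_tube hT₂ hreg₂ hlt₂ hout₂
  exact BoundaryGluingData.exists_signature_fibreSum_eq_add_of_interior_homeomorph G₁ G₂ G
    (e₁ : ManifoldInterior 3 cN₁.W ≃ₜ _) (e₂ : ManifoldInterior 3 cN₂.W ≃ₜ _) μ₁ μ₂ μ

end Tube

end Literature.Topology.FourManifolds

end
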